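import Summits.HodgeConjecture.HodgeConjecture.Theorems.K2E5QuatZetaAbsConvOfThetaBoundsRates   -- ★ (β) with rates (p855790): `quatZeta_majorant_integrable_of_thetaBounds_rates`
import Summits.HodgeConjecture.HodgeConjecture.Theorems.K2E5QuatUnitsOneCocompact             -- ★ G1′ (K2E5-p03, p855765): `quatUnitsOneCocompact` (Fujisaki) + Prep `exists_isCompact_image_superset_of_isOpenMap`
import HarnessLib

/-!
# K2 ∕ E5 «TamagawaUnitary» — tier-2 file `K2E5QuatZetaAbsConvOfThetaTail`: the (g) CORE with (H2) DISCHARGED BY NAME (Fujisaki ★ G1′) and (H3±) in ONE family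

Track B «K2-LIT», engine E5, crux H413 (`stmt-HodgeConjecture-24833`); seat K2E5-p07 (g0); third layer of the (g) deal (BATCH #8, K2E5-plan (g0) → RULING (A)(2) K2E5-plan (g2)):
* §1 `exists_isCompact_forall_mul_mem` — a compact quotient `D^{(1)}_{h,𝔸} ∕ Γ_h` gives a COMPACT set `K ⊆ D^{(1)}_{h,𝔸}` meeting every `Γ_h`-coset (`∀ y, ∃ γ, y γ ∈ K`; ★ Prep
  `exists_isCompact_image_superset_of_isOpenMap` at the open quotient map); `quotientMeasure_univ_lt_top` — and FINITE covolume (the quotient measure is Radon).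
* §2 `quatZeta_majorant_integrable_of_thetaTail` ∕ `quatZeta_integrable_of_thetaTail` — for `h` hermitian ANISOTROPIC non-degenerate, every Haar-type pair `(dx, dx¹)` tied by
  Tate's disintegration (H1) (= socket G3's own hypothesis, carried verbatim), every `Φ ∈ 𝒮(M₂(𝔸_L))|_{D_h}` and every real `σ > 1`: the majorant `‖Φ x‖·|det x|^σ` and the
  `quatZeta` integrand are `dx`-integrable, GIVEN the theta-tail family (H3) in EXACTLY the shape of K2E5-p01 (g2)'s `K2E5QuatThetaBounds.thetaTail_le_exp`
  (REPORT-FIRST 2026-09-03T23:42Z): `∀ K compact, ∀ κ > 1, ∃ B ≠ ⊤, ∀ y ∈ K, ∀ t, Σ'_γ ‖Φ(y γ θ_t)‖ₑ ≤ B · e^{−κ t}` — instantiated at `κ₁ := (1+σ)/2` (contracting side) and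
  `κ₂ := σ + 1` (expanding side) and fed to ★ `quatZeta_majorant_integrable_of_thetaBounds_rates`; (H2) is no longer a hypothesis: ★ G1′ `quatUnitsOneCocompact`.
The by-name final file `Theorems/K2E5QuatZetaAbsConv.lean` is then `quatZeta_integrable_of_thetaTail … (fun K hK κ hκ => thetaTail_le_exp …)` once p01's head lands.
No `sorry`, axioms ⊆ the trio, no `instance`, no `notation`.

HONEST LABEL: HC_CM is proved only modulo the 7 printed citations (2 remaining named inputs: hLiu418 = stmt-HodgeConjecture-24832, h413 = stmt-HodgeConjecture-24833) until rung 0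
closes; this file is a helper (`--supports stmt-HodgeConjecture-24833 --as helper`) and changes no count.

## References
[WeilBNT1967] A. Weil, *Basic Number Theory* (1967), Ch. IV §3 Thm. 4 (Fujisaki), Ch. VII §5 Prop. 11 · [TateThesis1967] J. Tate, in Cassels–Fröhlich (1967), Ch. XV §4.4 ·
[VignerasLNM800] M.-F. Vignéras, LNM 800 (1980), Ch. III §2 Thm. 2.2.
-/

set_option autoImplicit false
set_option linter.dupNamespace false

noncomputable section

namespace Summit.HodgeConjecture.HodgeConjecture.Cruxes.H413.K2E5QuatZetaAbsConvOfThetaBounds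

open NumberField IsDedekindDomain MeasureTheory MeasureTheory.Measure Filter Topology Set
open scoped Matrix MatrixGroups NNReal ENNReal
open Literature.MeasureTheory.Group Literature.NumberTheory Literature.NumberTheory.Automorphic
open Literature.AlgebraicGeometry.ShimuraVarieties (hermForm)
open Summit.HodgeConjecture.HodgeConjecture.Cruxes.H413.K2E5QuatAdelicMatrixModel
open Summit.HodgeConjecture.HodgeConjecture.Cruxes.H413.K2E5QuatZeta
open Summit.HodgeConjecture.HodgeConjecture.Cruxes.H413.K2E5QuatAdelicLattice
open Summit.HodgeConjecture.HodgeConjecture.Cruxes.H413.K2E5QuatAdelicModuleOne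
open Summit.HodgeConjecture.HodgeConjecture.Cruxes.H413.K2E5QuatZetaAbsConvReduction

/-! ## §1 Compact quotient ⇒ a compact set meeting every coset, and finite covolume -/

/-- In a (weakly) locally compact group `G` with a subgroup `Γ` of COMPACT quotient `G ⧸ Γ`, some compact `K ⊆ G` meets every coset: `∀ y, ∃ γ ∈ Γ, y γ ∈ K`
(lift `univ` through the open quotient map). [cite: WeilBNT1967, Ch. IV §3 Thm. 4] -/
theorem exists_isCompact_forall_mul_mem {G : Type*} [Group G] [TopologicalSpace G] [IsTopologicalGroup G] [WeaklyLocallyCompactSpace G]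
    (Γ : Subgroup G) [CompactSpace (G ⧸ Γ)] : ∃ K : Set G, IsCompact K ∧ ∀ y : G, ∃ γ : ↥Γ, y * γ ∈ K := by
  obtain ⟨C, hC, hcov⟩ := K2E5QuatUnitsOneCocompactPrep.exists_isCompact_image_superset_of_isOpenMap
    (QuotientGroup.isOpenMap_coe (N := Γ)) isCompact_univ (fun q _ => QuotientGroup.mk_surjective q)
  refine ⟨C, hC, fun y => ?_⟩
  obtain ⟨c, hc, hcy⟩ := hcov (mem_univ (QuotientGroup.mk y : G ⧸ Γ))
  refine ⟨⟨y⁻¹ * c, ?_⟩, by simpa only [mul_inv_cancel_left] using hc⟩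
  exact QuotientGroup.eq.1 hcy.symm

/-- On a COMPACT quotient `G ⧸ Γ` the invariant quotient measure (★ `quotientMeasure`, a Radon measure) has finite total mass. [cite: WeilBNT1967, Ch. IV §3 Thm. 4] -/
theorem quotientMeasure_univ_lt_top {G : Type*} [Group G] [TopologicalSpace G] [IsTopologicalGroup G] [LocallyCompactSpace G] [SecondCountableTopology G] [T2Space G]
    (Γ : Subgroup G) [MeasurableSpace ↥Γ] [BorelSpace ↥Γ] (ρ : Measure ↥Γ) [ρ.IsMulLeftInvariant] [IsFiniteMeasureOnCompacts ρ] [ρ.IsOpenPosMeasure]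
    (hΓ : IsClosed (Γ : Set G)) [MeasurableSpace G] [BorelSpace G] [ρ.IsInvInvariant] (ν : Measure G) [IsFiniteMeasureOnCompacts ν] [ν.IsMulRightInvariant]
    [MeasurableSpace (G ⧸ Γ)] [BorelSpace (G ⧸ Γ)] [CompactSpace (G ⧸ Γ)] : quotientMeasure Γ ρ hΓ ν univ < ⊤ :=
  isCompact_univ.measure_lt_top

/-! ## §2 The core estimate from the theta-tail family -/

section Core

set_option synthInstance.maxHeartbeats 400000
set_option maxHeartbeats 1600000

variable (L : Type) [Field L] [NumberField L] [IsCMField L] {Ha : Matrix (Fin 2) (Fin 2) L}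
  (hHa : (Ha.map (cmConjRingHom L)).transpose = Ha) (hdet : Ha.det ≠ 0)
  [MeasurableSpace (GL (Fin 2) (AdeleRing (𝓞 L) L))] [BorelSpace (GL (Fin 2) (AdeleRing (𝓞 L) L))]
  [MeasurableSpace (↥(quatAdelicUnitsOne L Ha) ⧸ quatRatLatticeOne L Ha)] [BorelSpace (↥(quatAdelicUnitsOne L Ha) ⧸ quatRatLatticeOne L Ha)]
  [LocallyCompactSpace ↥(quatAdelicUnitsOne L Ha)] [SecondCountableTopology ↥(quatAdelicUnitsOne L Ha)] [T2Space ↥(quatAdelicUnitsOne L Ha)]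

/-- **THE CORE ESTIMATE FROM THE THETA-TAIL FAMILY** (`σ > 1`): the real majorant `‖Φ x‖ · |det x|_𝔸^σ` is `dx`-integrable on `(D_h ⊗ 𝔸)^×`, given Tate's disintegration (H1) and
the theta-tail bounds (H3) at every rate `κ > 1` on every compact set (K2E5-p01's `thetaTail_le_exp` shape); finite covolume and the compact covering set come from ★ G1′
(Fujisaki).  [cite: WeilBNT1967, Ch. VII §5 Prop. 11] [cite: TateThesis1967, §4.4] [cite: VignerasLNM800, Ch. III §2 Thm. 2.2] -/
theorem quatZeta_majorant_integrable_of_thetaTail (hanis : ∀ x : Fin 2 → L, hermForm (cmConjRingHom L) Ha x x = 0 → x = 0)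
    (dx : Measure ↥(quatAdelicUnits L Ha))
    (dx1 : Measure ↥(quatAdelicUnitsOne L Ha)) [dx1.IsHaarMeasure] [dx1.IsMulRightInvariant]
    [(count : Measure ↥(quatRatLatticeOne L Ha)).IsHaarMeasure]
    -- (H1) Tate's disintegration `dx = dx¹ ⊗ dt` (verbatim the hypothesis of socket G3)
    (hdis : ∀ f : ↥(quatAdelicUnits L Ha) → ℝ≥0∞, Measurable f →
      ∫⁻ x, f x ∂dx = ∫⁻ t : ℝ, ∫⁻ y, f ((y : ↥(quatAdelicUnits L Ha)) *
        quatModuleSection L Ha (Units.mk0 (Real.toNNReal (Real.exp t)) (Real.toNNReal_pos.2 (Real.exp_pos t)).ne')) ∂dx1)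
    {Φ : Matrix (Fin 2) (Fin 2) (AdeleRing (𝓞 L) L) → ℂ}
    (hΦ : Φ ∈ quatSchwartzBruhat L (fun i => ((quatBasis L Ha hHa hdet i : ↥(quatRatSubalgebra L Ha)) : Matrix (Fin 2) (Fin 2) L)))
    {σ : ℝ} (hσ : 1 < σ)
    -- (H3) the theta-tail family, every rate `κ > 1`, every compact `K`
    (htheta : ∀ K : Set ↥(quatAdelicUnitsOne L Ha), IsCompact K → ∀ κ : ℝ, 1 < κ → ∃ B : ℝ≥0∞, B ≠ ⊤ ∧ ∀ y ∈ K, ∀ t : ℝ,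
      (∑' γ : ↥(quatRatLatticeOne L Ha), ‖Φ (((((y * γ : ↥(quatAdelicUnitsOne L Ha)) : ↥(quatAdelicUnits L Ha)) *
          quatModuleSection L Ha (Units.mk0 (Real.toNNReal (Real.exp t)) (Real.toNNReal_pos.2 (Real.exp_pos t)).ne') :
            GL (Fin 2) (AdeleRing (𝓞 L) L)) : Matrix (Fin 2) (Fin 2) (AdeleRing (𝓞 L) L)))‖ₑ) ≤ B * ENNReal.ofReal (Real.exp (-κ * t))) :
    Integrable (fun x : ↥(quatAdelicUnits L Ha) =>
      ‖Φ ((x : GL (Fin 2) (AdeleRing (𝓞 L) L)) : Matrix (Fin 2) (Fin 2) (AdeleRing (𝓞 L) L))‖ * ((quatModule L Ha x : ℝ≥0) : ℝ) ^ σ) dx := by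
  haveI : CompactSpace (↥(quatAdelicUnitsOne L Ha) ⧸ quatRatLatticeOne L Ha) := K2E5QuatUnitsOneCocompact.quatUnitsOneCocompact L Ha hHa hanis hdet
  haveI : IsClosed ((quatRatLatticeOne L Ha : Subgroup ↥(quatAdelicUnitsOne L Ha)) : Set ↥(quatAdelicUnitsOne L Ha)) := isClosed_quatRatLatticeOne L Ha
  obtain ⟨K, hKc, hK⟩ := exists_isCompact_forall_mul_mem (quatRatLatticeOne L Ha)
  have hcov : quotientMeasure (quatRatLatticeOne L Ha) (count : Measure ↥(quatRatLatticeOne L Ha)) (isClosed_quatRatLatticeOne L Ha) dx1 Set.univ < ⊤ :=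
    isCompact_univ.measure_lt_top
  obtain ⟨Bm, hBm, hm⟩ := htheta K hKc ((1 + σ) / 2) (by linarith)
  obtain ⟨Bp, hBp, hp⟩ := htheta K hKc (σ + 1) (by linarith)
  exact quatZeta_majorant_integrable_of_thetaBounds_rates L hHa hdet dx dx1 hdis hcov K hK hΦ (show (1 + σ) / 2 < σ by linarith) (show σ < σ + 1 by linarith)
    ⟨Bm, hBm, fun y hy t _ => hm y hy t⟩ ⟨Bp, hBp, fun y hy t _ => hp y hy t⟩

/-- **THE DEALT STATEMENT FROM THE THETA-TAIL FAMILY**: under the same hypotheses the `quatZeta` integrand `Φ(x) |det x|_𝔸^s` is `dx`-integrable at the real point `s = σ > 1`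
(★ (α) `integrable_quatZeta_integrand_iff`). [cite: WeilBNT1967, Ch. VII §5 Prop. 11] [cite: TateThesis1967, §4.4] -/
theorem quatZeta_integrable_of_thetaTail (hanis : ∀ x : Fin 2 → L, hermForm (cmConjRingHom L) Ha x x = 0 → x = 0)
    (dx : Measure ↥(quatAdelicUnits L Ha))
    (dx1 : Measure ↥(quatAdelicUnitsOne L Ha)) [dx1.IsHaarMeasure] [dx1.IsMulRightInvariant]
    [(count : Measure ↥(quatRatLatticeOne L Ha)).IsHaarMeasure]
    (hdis : ∀ f : ↥(quatAdelicUnits L Ha) → ℝ≥0∞, Measurable f →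
      ∫⁻ x, f x ∂dx = ∫⁻ t : ℝ, ∫⁻ y, f ((y : ↥(quatAdelicUnits L Ha)) *
        quatModuleSection L Ha (Units.mk0 (Real.toNNReal (Real.exp t)) (Real.toNNReal_pos.2 (Real.exp_pos t)).ne')) ∂dx1)
    {Φ : Matrix (Fin 2) (Fin 2) (AdeleRing (𝓞 L) L) → ℂ}
    (hΦ : Φ ∈ quatSchwartzBruhat L (fun i => ((quatBasis L Ha hHa hdet i : ↥(quatRatSubalgebra L Ha)) : Matrix (Fin 2) (Fin 2) L)))
    {σ : ℝ} (hσ : 1 < σ)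
    (htheta : ∀ K : Set ↥(quatAdelicUnitsOne L Ha), IsCompact K → ∀ κ : ℝ, 1 < κ → ∃ B : ℝ≥0∞, B ≠ ⊤ ∧ ∀ y ∈ K, ∀ t : ℝ,
      (∑' γ : ↥(quatRatLatticeOne L Ha), ‖Φ (((((y * γ : ↥(quatAdelicUnitsOne L Ha)) : ↥(quatAdelicUnits L Ha)) *
          quatModuleSection L Ha (Units.mk0 (Real.toNNReal (Real.exp t)) (Real.toNNReal_pos.2 (Real.exp_pos t)).ne') :
            GL (Fin 2) (AdeleRing (𝓞 L) L)) : Matrix (Fin 2) (Fin 2) (AdeleRing (𝓞 L) L)))‖ₑ) ≤ B * ENNReal.ofReal (Real.exp (-κ * t))) :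
    Integrable (fun x : ↥(quatAdelicUnits L Ha) =>
      Φ ((x : GL (Fin 2) (AdeleRing (𝓞 L) L)) : Matrix (Fin 2) (Fin 2) (AdeleRing (𝓞 L) L)) * (((quatModule L Ha x : ℝ≥0) : ℝ) : ℂ) ^ (σ : ℂ)) dx :=
  (integrable_quatZeta_integrand_iff L hHa hdet hΦ dx σ).2
    (quatZeta_majorant_integrable_of_thetaTail L hHa hdet hanis dx dx1 hdis hΦ hσ htheta)

end Core

end Summit.HodgeConjecture.HodgeConjecture.Cruxes.H413.K2E5QuatZetaAbsConvOfThetaBounds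

end
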